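import Mathlib
import Literature.NumberTheory.Automorphic.HilbertModularFormQExpansion
import Summits.Langlands.Langlands.Theorems.CapacityClassicalityHilbertIntegralOverconvergentIsCongruenceStubLeadConvolution
import Summits.Langlands.Langlands.Theorems.CapacityClassicalityHilbertIntegralOverconvergentIsCongruenceStubDistinctLeadIndep
import Summits.Langlands.Langlands.Theorems.CapacityClassicalityHilbertIntegralOverconvergentIsCongruenceStubConeClassMul
import Summits.Langlands.Langlands.Theorems.CapacityClassicalityHilbertIntegralOverconvergentIsCongruenceStubConeClassOne
import Summits.Langlands.Langlands.Theorems.CapacityClassicalityHilbertIntegralOverconvergentIsCongruenceStubFourierCoeffLinear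
import Summits.Langlands.Langlands.Theorems.CapacityClassicalityHilbertIntegralOverconvergentIsCongruenceKoecherGlue

/-!
# Leading exponents of monomials in cone-class functions (§ U of line Sketch-ideate-r1-k1, lead part 1)

Part 1 of the lead's composition `stub_supplyFromSeed` (RESHAPE 17, § U) for the crux
`HilbertIntegralOverconvergentIsCongruence` (stmt-Langlands-8485): the LEADING-EXPONENT PACKAGE.

A function `f` on the tube domain is in the *cone class* if it is holomorphic on `ℍ`, `𝓞 F`-periodic on `ℍ`, and its
Fourier coefficients at dual-lattice indices off the cone `qIndexSet F` vanish; its `q`-expansion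
`qExpansion f : F → ℂ` is then supported on the cone and multiplies by cone convolution (landed product formula
`stub_fourierCoeff_mul`, here repackaged for `qExpansion` as `sle_qExpansion_mul`).  Fix an additive injective
height `λ : F → ℝ`.  For a family `gf_l` of cone-class functions with prescribed LEADING POINTS `θ_l`
(`qExpansion (gf l) (θ l) ≠ 0`, and `λ (θ l) ≤ λ ν` whenever `qExpansion (gf l) ν ≠ 0`):

* `sle_multiset_lead` — every monomial `∏_{l ∈ t} gf_l` (`t` a multiset) is in the cone class, its `q`-expansion at
  `∑_{l ∈ t} θ_l` is `∏_{l ∈ t} qExpansion (gf l) (θ l)` (in particular non-zero), and every index in its support has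
  height `≥ λ(∑ θ_l)` (induction on `t` with the landed `stub_lead_convolution` and `stub_coneClass_mul/one`);
* `sle_monomials_independent` — if the leading points `∑_{l ∈ e} θ_l` of the monomials of a fixed degree `m` are
  pairwise distinct, the monomials are linearly independent as functions on `ℍ` (a relation on `ℍ` is a relation
  between `q`-expansions by linearity of `fourierCoeff`, `sle_fourierCoeff_finset_sum`, and then the landed
  `stub_distinct_lead_indep` applies).
-/

set_option linter.dupNamespace false

noncomputable section

namespace Summit.Langlands.Langlands.Theorems.HilbertIntegralOverconvergentIsCongruence

open MeasureTheory Complex NumberField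
open Literature.NumberTheory.Automorphic Literature.NumberTheory.Automorphic.HilbertModular

/-- The `q`-expansion is supported on the cone (it is the indicator of the cone times `fourierCoeff`). -/
theorem sle_mem_qIndexSet_of_qExpansion_ne_zero {F : Type} [Field F] [NumberField F] {f : Point F → ℂ} {ν : F} (h : qExpansion f ν ≠ 0) :
    ν ∈ qIndexSet F := by
  by_contra hν
  exact h (qExpansion_of_not_mem hν)

/-- A function vanishing on `ℍ` has all Fourier coefficients `0` (the cube `[0,1]^ι + i·1` lies in `ℍ`). -/
theorem sle_fourierCoeff_eq_zero_of_eqOn {F : Type} [Field F] [NumberField F] {g : Point F → ℂ} (hg : ∀ z ∈ halfSpace F, g z = 0) (ν : F) :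
    fourierCoeff g ν = 0 := by
  rw [fourierCoeff_eq, fourierCoeffAt]
  have : (fun x : Coord F ↦ g (cubePoint x fun _ ↦ (1 : ℝ)) *
      cexp (-(2 * Real.pi * I * pairing ν (cubePoint x fun _ ↦ (1 : ℝ))))) = fun _ ↦ 0 := by
    funext x
    rw [hg _ (koe_cubePoint_mem_halfSpace x (fun _ ↦ one_pos)), zero_mul]
  rw [this]
  simp

/-- Linearity of `fourierCoeff` over finite linear combinations of functions continuous on `ℍ`
(iterating the landed `stub_fourierCoeff_linear`). -/
theorem sle_fourierCoeff_finset_sum {F : Type} [Field F] [NumberField F] {ι : Type} (s : Finset ι) (g : ι → Point F → ℂ) (κ : ι → ℂ)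
    (hg : ∀ e ∈ s, ContinuousOn (g e) (halfSpace F)) (ν : F) :
    fourierCoeff (∑ e ∈ s, κ e • g e) ν = ∑ e ∈ s, κ e * fourierCoeff (g e) ν := by
  classical
  induction s using Finset.induction_on with
  | empty =>
    simp only [Finset.sum_empty]
    exact (stub_fourierCoeff_linear F 0 0 continuousOn_const continuousOn_const 0 ν (fun _ ↦ 1)
      fun _ ↦ one_pos).2.2
  | @insert a s ha ih =>
    rw [Finset.sum_insert ha, Finset.sum_insert ha]
    have hga : ContinuousOn (g a) (halfSpace F) := hg a (Finset.mem_insert_self a s)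
    have hgs : ∀ e ∈ s, ContinuousOn (g e) (halfSpace F) := fun e he ↦ hg e (Finset.mem_insert_of_mem he)
    have hcont_sum : ContinuousOn (∑ e ∈ s, κ e • g e) (halfSpace F) := by
      rw [Finset.sum_fn]
      exact continuousOn_finsetSum s fun e he ↦ (hgs e he).const_smul (κ e)
    have hcont_a : ContinuousOn (κ a • g a) (halfSpace F) := hga.const_smul (κ a)
    obtain ⟨hadd, -, -⟩ := stub_fourierCoeff_linear F (κ a • g a) (∑ e ∈ s, κ e • g e) hcont_a hcont_sum 0 ν
      (fun _ ↦ 1) (fun _ ↦ one_pos)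
    obtain ⟨-, hsmul, -⟩ := stub_fourierCoeff_linear F (g a) (g a) hga hga (κ a) ν (fun _ ↦ 1) (fun _ ↦ one_pos)
    rw [fourierCoeff_eq, hadd, hsmul, ← ih hgs]
    rfl

/-- The product formula for `q`-expansions of cone-class functions: `qExpansion (f g)` is the cone convolution of
`qExpansion f` and `qExpansion g` (the landed `stub_fourierCoeff_mul` on the cone; off the cone both sides vanish,
the cone being closed under addition). -/
theorem sle_qExpansion_mul {F : Type} [Field F] [NumberField F] [NumberField.IsTotallyReal F] (f g : Point F → ℂ)
    (hf : IsHolomorphicOn F f) (hg : IsHolomorphicOn F g)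
    (hperf : ∀ (a : 𝓞 F) (z : Point F), z ∈ halfSpace F → f (fun σ ↦ z σ + ((σ (a : F) : ℝ) : ℂ)) = f z)
    (hperg : ∀ (a : 𝓞 F) (z : Point F), z ∈ halfSpace F → g (fun σ ↦ z σ + ((σ (a : F) : ℝ) : ℂ)) = g z)
    (hsf : ∀ μ : F, (∀ a : 𝓞 F, ∃ n : ℤ, Algebra.trace ℚ F (μ * a) = n) → μ ∉ qIndexSet F → fourierCoeff f μ = 0)
    (hsg : ∀ μ : F, (∀ a : 𝓞 F, ∃ n : ℤ, Algebra.trace ℚ F (μ * a) = n) → μ ∉ qIndexSet F → fourierCoeff g μ = 0)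
    (ν : F) (T : Finset (F × F))
    (hT : ∀ μ : F × F, μ ∈ T ↔ μ.1 ∈ qIndexSet F ∧ μ.2 ∈ qIndexSet F ∧ μ.1 + μ.2 = ν) :
    qExpansion (f * g) ν = ∑ μ ∈ T, qExpansion f μ.1 * qExpansion g μ.2 := by
  by_cases hν : ν ∈ qIndexSet F
  · rw [qExpansion_of_mem hν,
      stub_fourierCoeff_mul F f g hf hg hperf hperg hsf hsg ν (mem_qIndexSet_iff.mp hν).1 T hT]
    refine Finset.sum_congr rfl fun μ hμ ↦ ?_
    obtain ⟨h1, h2, -⟩ := (hT μ).1 hμ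
    rw [qExpansion_of_mem h1, qExpansion_of_mem h2]
  · rw [qExpansion_of_not_mem hν]
    have hT0 : T = ∅ := Finset.eq_empty_of_forall_notMem fun μ hμ ↦ by
      obtain ⟨h1, h2, h3⟩ := (hT μ).1 hμ
      exact hν (h3 ▸ emu_add_mem_qIndexSet h1 h2)
    rw [hT0, Finset.sum_empty]

/-- Pointwise evaluation of a multiset product of functions. -/
theorem sle_multiset_prod_apply {F : Type} [Field F] {ι : Type} (t : Multiset ι) (g : ι → Point F → ℂ) (z : Point F) :
    (t.map g).prod z = (t.map (fun l ↦ g l z)).prod := by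
  induction t using Multiset.induction_on with
  | empty => simp
  | cons a t ih => simp [ih]

/-- **Leading exponents of monomials.**  For cone-class functions `gf_l` with leading points `θ_l` for the height `λ`
(non-zero `q`-expansion at `θ_l`, and every support index has height `≥ λ(θ_l)`), every monomial `∏_{l ∈ t} gf_l` is
in the cone class, has `q`-expansion `∏ qExpansion (gf l) (θ l)` at `∑_{l ∈ t} θ_l`, and its support lies at heights
`≥ λ(∑ θ_l)` (induction on the multiset with the landed `stub_lead_convolution`). -/
theorem sle_multiset_lead {F : Type} [Field F] [NumberField F] [NumberField.IsTotallyReal F] {ι : Type} (gf : ι → Point F → ℂ)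
    (hhol : ∀ l, IsHolomorphicOn F (gf l))
    (hper : ∀ l (a : 𝓞 F) (z : Point F), z ∈ halfSpace F →
      gf l (fun σ ↦ z σ + ((σ (a : F) : ℝ) : ℂ)) = gf l z)
    (hsupp : ∀ l (μ : F), (∀ a : 𝓞 F, ∃ n : ℤ, Algebra.trace ℚ F (μ * a) = n) → μ ∉ qIndexSet F →
      fourierCoeff (gf l) μ = 0)
    (lam : F →+ ℝ) (hlam : Function.Injective lam) (θ : ι → F)
    (hlc : ∀ l, qExpansion (gf l) (θ l) ≠ 0)
    (hmin : ∀ l ν, qExpansion (gf l) ν ≠ 0 → lam (θ l) ≤ lam ν) (t : Multiset ι) :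
    IsHolomorphicOn F (t.map gf).prod ∧
    (∀ (a : 𝓞 F) (z : Point F), z ∈ halfSpace F →
      (t.map gf).prod (fun σ ↦ z σ + ((σ (a : F) : ℝ) : ℂ)) = (t.map gf).prod z) ∧
    (∀ μ : F, (∀ a : 𝓞 F, ∃ n : ℤ, Algebra.trace ℚ F (μ * a) = n) → μ ∉ qIndexSet F →
      fourierCoeff (t.map gf).prod μ = 0) ∧
    qExpansion (t.map gf).prod (t.map θ).sum = (t.map (fun l ↦ qExpansion (gf l) (θ l))).prod ∧
    ∀ ν, qExpansion (t.map gf).prod ν ≠ 0 → lam (t.map θ).sum ≤ lam ν := by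
  induction t using Multiset.induction_on with
  | empty =>
    obtain ⟨h1hol, h1per, h10, h1off⟩ := stub_coneClass_one F
    simp only [Multiset.map_zero, Multiset.prod_zero, Multiset.sum_zero]
    refine ⟨h1hol, h1per, fun μ hμ hμc ↦ h1off μ hμ (fun h ↦ hμc (h ▸ zero_mem_qIndexSet)), ?_, fun ν hν ↦ ?_⟩
    · rw [qExpansion_of_mem zero_mem_qIndexSet, h10]
    · have hνc := sle_mem_qIndexSet_of_qExpansion_ne_zero hν
      by_cases h0 : ν = 0
      · rw [h0]
      · rw [qExpansion_of_mem hνc] at hν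
        exact absurd (h1off ν (mem_qIndexSet_iff.mp hνc).1 h0) hν
  | cons l t ih =>
    obtain ⟨ihhol, ihper, ihsupp, ihlead, ihmin⟩ := ih
    simp only [Multiset.map_cons, Multiset.prod_cons, Multiset.sum_cons]
    obtain ⟨hmhol, hmper, hmsupp⟩ :=
      stub_coneClass_mul F (gf l) (t.map gf).prod (hhol l) ihhol (hper l) ihper (hsupp l) ihsupp
    have hb0 : qExpansion (t.map gf).prod (t.map θ).sum ≠ 0 := by
      rw [ihlead]
      refine Multiset.prod_ne_zero fun h ↦ ?_
      obtain ⟨l', -, hl'⟩ := Multiset.mem_map.mp h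
      exact hlc l' hl'
    obtain ⟨hceq, hcmin⟩ := stub_lead_convolution F lam hlam (qExpansion (gf l)) (qExpansion (t.map gf).prod)
      (qExpansion (gf l * (t.map gf).prod)) (fun ν h ↦ sle_mem_qIndexSet_of_qExpansion_ne_zero h)
      (fun ν h ↦ sle_mem_qIndexSet_of_qExpansion_ne_zero h)
      (fun ν T hT ↦ sle_qExpansion_mul (gf l) (t.map gf).prod (hhol l) ihhol (hper l) ihper (hsupp l) ihsupp ν T hT)
      (θ l) (t.map θ).sum (hlc l) hb0 (hmin l) ihmin
    refine ⟨hmhol, hmper, hmsupp, ?_, hcmin⟩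
    rw [hceq, ihlead]

/-- **Monomials with pairwise distinct leading points are linearly independent on `ℍ`.**  In the setting of
`sle_multiset_lead`, if `e ↦ ∑_{l ∈ e} θ_l` is injective on the monomial exponents of degree `m`, then a relation
`∑_e κ_e ∏_{l ∈ e} gf_l(z) = 0` for all `z ∈ ℍ` forces `κ = 0` (pass to `q`-expansions and apply the landed
`stub_distinct_lead_indep`). -/
theorem sle_monomials_independent {F : Type} [Field F] [NumberField F] [NumberField.IsTotallyReal F] {ι : Type} [Fintype ι] [DecidableEq ι]
    (gf : ι → Point F → ℂ) (hhol : ∀ l, IsHolomorphicOn F (gf l))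
    (hper : ∀ l (a : 𝓞 F) (z : Point F), z ∈ halfSpace F →
      gf l (fun σ ↦ z σ + ((σ (a : F) : ℝ) : ℂ)) = gf l z)
    (hsupp : ∀ l (μ : F), (∀ a : 𝓞 F, ∃ n : ℤ, Algebra.trace ℚ F (μ * a) = n) → μ ∉ qIndexSet F →
      fourierCoeff (gf l) μ = 0)
    (lam : F →+ ℝ) (hlam : Function.Injective lam) (θ : ι → F)
    (hlc : ∀ l, qExpansion (gf l) (θ l) ≠ 0)
    (hmin : ∀ l ν, qExpansion (gf l) ν ≠ 0 → lam (θ l) ≤ lam ν) (m : ℕ)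
    (hinjlead : Function.Injective (fun e : Sym ι m ↦ ((e : Multiset ι).map θ).sum))
    (κ : Sym ι m → ℂ)
    (hrel : ∀ z ∈ halfSpace F, ∑ e, κ e * ((e : Multiset ι).map (fun l ↦ gf l z)).prod = 0) :
    ∀ e, κ e = 0 := by
  refine stub_distinct_lead_indep lam hlam (fun e : Sym ι m ↦ qExpansion (((e : Sym ι m) : Multiset ι).map gf).prod)
    (fun e : Sym ι m ↦ (((e : Sym ι m) : Multiset ι).map θ).sum) hinjlead (fun e ↦ ?_) (fun e ν hν ↦ ?_) κ
    (fun ν ↦ ?_)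
  · obtain ⟨-, -, -, hlead, -⟩ := sle_multiset_lead gf hhol hper hsupp lam hlam θ hlc hmin (e : Multiset ι)
    rw [hlead]
    refine Multiset.prod_ne_zero fun h ↦ ?_
    obtain ⟨l', -, hl'⟩ := Multiset.mem_map.mp h
    exact hlc l' hl'
  · exact (sle_multiset_lead gf hhol hper hsupp lam hlam θ hlc hmin (e : Multiset ι)).2.2.2.2 ν hν
  · by_cases hν : ν ∈ qIndexSet F
    · have hcont : ∀ e ∈ (Finset.univ : Finset (Sym ι m)),
          ContinuousOn ((e : Multiset ι).map gf).prod (halfSpace F) :=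
        fun e _ ↦ (sle_multiset_lead gf hhol hper hsupp lam hlam θ hlc hmin (e : Multiset ι)).1.continuousOn
      have hsum := sle_fourierCoeff_finset_sum Finset.univ
        (fun e : Sym ι m ↦ (((e : Sym ι m) : Multiset ι).map gf).prod) κ hcont ν
      have hzero : fourierCoeff (∑ e : Sym ι m, κ e • (((e : Sym ι m) : Multiset ι).map gf).prod) ν = 0 := by
        refine sle_fourierCoeff_eq_zero_of_eqOn (fun z hz ↦ ?_) ν
        rw [Finset.sum_apply]
        simp only [Pi.smul_apply, smul_eq_mul, sle_multiset_prod_apply]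
        exact hrel z hz
      simp only [qExpansion_of_mem hν]
      rw [← hsum]
      exact hzero
    · simp only [qExpansion_of_not_mem hν, mul_zero, Finset.sum_const_zero]

end Summit.Langlands.Langlands.Theorems.HilbertIntegralOverconvergentIsCongruence

end
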